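import Summits.Ventures.PercRepro.ProfilePointedCircuitClassesStarNineDefectB

/-!
# PercRepro — THE DEFECT FORM OF (★)₉, PART C: THE INTERFACE `|D_e| ≤ |D_f| + |C| ⟹ (★)₉`
(p5, gen 57; `proofs/P5-GM1.md` §85 ADD 2(a))

With `X := E − e − f`, `G_e := {τ ⊆ X : #τ = 3, τ + e ∈ BI₄}`, `G_f` likewise and `C := {π ⊆ X : #π = 2, π + e + f ∈ BI₄}`:
`in_4(e) = |G_e| + |C|`, `in_4(f) = |G_f| + |C|`, `thru_4({e, f}) = |C|` (the bijections `τ ↦ τ + e`, `π ↦ π + e + f`), so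
(★)₉ at `(e, f)` is `|G_e| ≤ |G_f| + |C|`, i.e. `|D_e| ≤ |D_f| + |C|` for the defects `D_e := G_e − G_f`, `D_f := G_f − G_e`
(`starNine_of_defect_bound`).  This is the statement the successor proves on the simple cosimple core; `cpair_of_defect`
(part B) is its first structural lemma.
-/

open scoped Matroid

namespace PercRepro.Cogirth

open Finset ThmH Skew Shadow Profile

open Classical

variable {α : Type} [DecidableEq α] {N : Matroid α} [N.Finite]

section StarNineDefectC

/-- The triples `τ ⊆ E − e − f` with `τ + p` bi-independent (`p ∈ {e, f}`). -/
noncomputable def defTriples (N : Matroid α) [N.Finite] (e f p : α) : Finset (Finset α) :=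
  ((((gr N).erase e).erase f).powersetCard 3).filter (fun τ => insert p τ ∈ biIndepSets N 4)

/-- The pairs `π ⊆ E − e − f` with `π + e + f` bi-independent (the `C`-pairs). -/
noncomputable def cPairs (N : Matroid α) [N.Finite] (e f : α) : Finset (Finset α) :=
  ((((gr N).erase e).erase f).powersetCard 2).filter (fun π => insert e (insert f π) ∈ biIndepSets N 4)

/-- **`in_4(p) − thru_4({e, f}) = |G_p|`**: the bi-independent `4`-sets through `p` avoiding `q` are the lifts `τ + p` of
the triples of `E − e − f` with `τ + p` bi-independent (`{p, q} = {e, f}`). -/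
theorem card_filter_mem_notMem_eq_card_defTriples {e f p q : α} (hpq : p ≠ q)
    (hX : ((gr N).erase e).erase f = ((gr N).erase p).erase q) :
    ((biIndepSets N 4).filter (fun W => p ∈ W ∧ q ∉ W)).card = (defTriples N e f p).card := by
  unfold defTriples
  rw [hX]
  symm
  apply card_bij (fun τ _ => insert p τ)
  · intro τ hτ
    rw [mem_filter, mem_powersetCard] at hτ
    rw [mem_filter]
    refine ⟨hτ.2, mem_insert_self _ _, ?_⟩
    rw [mem_insert]
    rintro (h | h)
    · exact hpq h.symm
    · exact (mem_erase.1 (hτ.1.1 h)).1 rfl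
  · intro τ hτ τ' hτ' heq
    rw [mem_filter, mem_powersetCard] at hτ hτ'
    have hpτ : p ∉ τ := fun h => (mem_erase.1 (mem_erase.1 (hτ.1.1 h)).2).1 rfl
    have hpτ' : p ∉ τ' := fun h => (mem_erase.1 (mem_erase.1 (hτ'.1.1 h)).2).1 rfl
    rw [← erase_insert hpτ, ← erase_insert hpτ', heq]
  · intro W hW
    rw [mem_filter] at hW
    obtain ⟨hWb, hpW, hqW⟩ := hW
    refine ⟨W.erase p, ?_, insert_erase hpW⟩
    rw [mem_filter, mem_powersetCard]
    have hWg := (mem_biIndepSets.1 hWb).1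
    have hW4 := (mem_biIndepSets.1 hWb).2.1
    refine ⟨⟨?_, by rw [card_erase_of_mem hpW, hW4]⟩, by rw [insert_erase hpW]; exact hWb⟩
    intro x hx
    have hxp : x ≠ p := (mem_erase.1 hx).1
    have hxW : x ∈ W := (mem_erase.1 hx).2
    exact mem_erase.2 ⟨fun h => hqW (h ▸ hxW), mem_erase.2 ⟨hxp, hWg hxW⟩⟩

/-- **`thru_4({e, f}) = |C|`**: the bi-independent `4`-sets through `e, f` are the lifts `π + e + f` of the `C`-pairs. -/
theorem thruCount_pair_eq_card_cPairs {e f : α} (hef : e ≠ f) : thruCount N 4 {e, f} = (cPairs N e f).card := by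
  unfold thruCount cPairs
  symm
  apply card_bij (fun π _ => insert e (insert f π))
  · intro π hπ
    rw [mem_filter, mem_powersetCard] at hπ
    rw [mem_filter]
    exact ⟨hπ.2, insert_subset (mem_insert_self _ _) (singleton_subset_iff.2 (mem_insert_of_mem (mem_insert_self _ _)))⟩
  · intro π hπ π' hπ' heq
    rw [mem_filter, mem_powersetCard] at hπ hπ'
    have heπ : e ∉ insert f π := by
      rw [mem_insert]; rintro (h | h)
      · exact hef h
      · exact (mem_erase.1 (mem_erase.1 (hπ.1.1 h)).2).1 rfl
    have heπ' : e ∉ insert f π' := by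
      rw [mem_insert]; rintro (h | h)
      · exact hef h
      · exact (mem_erase.1 (mem_erase.1 (hπ'.1.1 h)).2).1 rfl
    have hfπ : f ∉ π := fun h => (mem_erase.1 (hπ.1.1 h)).1 rfl
    have hfπ' : f ∉ π' := fun h => (mem_erase.1 (hπ'.1.1 h)).1 rfl
    have h1 := congrArg (fun S : Finset α => (S.erase e).erase f) heq
    simp only [erase_insert heπ, erase_insert heπ', erase_insert hfπ, erase_insert hfπ'] at h1
    exact h1
  · intro W hW
    rw [mem_filter] at hW
    obtain ⟨hWb, hsub⟩ := hW
    have heW : e ∈ W := hsub (mem_insert_self _ _)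
    have hfW : f ∈ W := hsub (mem_insert_of_mem (mem_singleton_self _))
    refine ⟨(W.erase e).erase f, ?_, ?_⟩
    · rw [mem_filter, mem_powersetCard]
      have hWg := (mem_biIndepSets.1 hWb).1
      have hW4 := (mem_biIndepSets.1 hWb).2.1
      have hfWe : f ∈ W.erase e := mem_erase.2 ⟨hef.symm, hfW⟩
      refine ⟨⟨?_, by rw [card_erase_of_mem hfWe, card_erase_of_mem heW, hW4]⟩, ?_⟩
      · intro x hx
        exact mem_erase.2 ⟨(mem_erase.1 hx).1, mem_erase.2 ⟨(mem_erase.1 (mem_erase.1 hx).2).1,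
          hWg (mem_erase.1 (mem_erase.1 hx).2).2⟩⟩
      · rw [insert_erase hfWe, insert_erase heW]; exact hWb
    · have hfWe : f ∈ W.erase e := mem_erase.2 ⟨hef.symm, hfW⟩
      rw [insert_erase hfWe, insert_erase heW]

/-- **THE DEFECT FORM OF (★)₉**: `|D_e| ≤ |D_f| + |C|` implies `in_4(e) ≤ in_4(f) + thru_4({e, f})`, where
`D_e = G_e − G_f`, `D_f = G_f − G_e` are the defect triples and `C` the `C`-pairs of `E − e − f`. -/
theorem starNine_of_defect_bound {e f : α} (hef : e ≠ f)
    (h : (defTriples N e f e \ defTriples N e f f).card ≤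
      (defTriples N e f f \ defTriples N e f e).card + (cPairs N e f).card) :
    inCount N 4 e ≤ inCount N 4 f + thruCount N 4 {e, f} := by
  have hXe : ((gr N).erase e).erase f = ((gr N).erase e).erase f := rfl
  have hXf : ((gr N).erase e).erase f = ((gr N).erase f).erase e := erase_right_comm
  have hGe := card_filter_mem_notMem_eq_card_defTriples (N := N) (e := e) (f := f) hef hXe
  have hGf := card_filter_mem_notMem_eq_card_defTriples (N := N) (e := e) (f := f) hef.symm hXf
  have hC := thruCount_pair_eq_card_cPairs (N := N) hef
  have hDe := card_filter_eq_sum_two (biIndepSets N 4) (fun W => e ∈ W) f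
  have hDf := card_filter_eq_sum_two (biIndepSets N 4) (fun W => f ∈ W) e
  have hthru : thruCount N 4 {e, f} = ((biIndepSets N 4).filter (fun W => e ∈ W ∧ f ∈ W)).card := by
    unfold thruCount
    exact congrArg Finset.card (filter_congr (fun W _ => by rw [insert_subset_iff, singleton_subset_iff]))
  have hcomm : ((biIndepSets N 4).filter (fun W => f ∈ W ∧ e ∈ W)).card =
      ((biIndepSets N 4).filter (fun W => e ∈ W ∧ f ∈ W)).card :=
    congrArg Finset.card (filter_congr (fun W _ => and_comm))
  -- the defect decomposition of the triple counts
  have hsplit : ∀ A B : Finset (Finset α), A.card = (A \ B).card + (A ∩ B).card := by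
    intro A B
    rw [← card_sdiff_add_card_inter A B]
  have hinter : (defTriples N e f f ∩ defTriples N e f e).card = (defTriples N e f e ∩ defTriples N e f f).card := by
    rw [inter_comm]
  unfold inCount
  rw [hDe, hDf, hGe, hGf, hthru, hcomm, hsplit (defTriples N e f e) (defTriples N e f f),
    hsplit (defTriples N e f f) (defTriples N e f e), hinter]
  omega

end StarNineDefectC

end PercRepro.Cogirth
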